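import Summits.ResolutionOfSingularities.ResolutionOfSingularities.Theses.RadicialJung
import Summits.ResolutionOfSingularities.ResolutionOfSingularities.Theorems.RadicialJungCleanModelsT2CleanModelsDimLETwoOverField
import Summits.ResolutionOfSingularities.ResolutionOfSingularities.Theorems.RadicialJungCleanModelsReductionAt
import Summits.ResolutionOfSingularities.ResolutionOfSingularities.Theorems.RadicialJungCleanModelsStubStacks0BICLocus
import Summits.ResolutionOfSingularities.ResolutionOfSingularities.Theorems.RadicialJungCleanModelsCleanPatchingDefs
import Summits.ResolutionOfSingularities.ResolutionOfSingularities.Theorems.RadicialJungCleanModelsStubCleanCharts3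
import Summits.ResolutionOfSingularities.ResolutionOfSingularities.Theorems.RadicialJungCleanModelsStubCleanTwoModelPatching3
import Summits.ResolutionOfSingularities.ResolutionOfSingularities.Theorems.RadicialJungCleanModelsStubCleanGlobalization3
import Summits.ResolutionOfSingularities.ResolutionOfSingularities.Theorems.RadicialJungCleanModelsStubCleanPointBlowup
import Summits.ResolutionOfSingularities.ResolutionOfSingularities.Theorems.RadicialJungCleanModelsCleanPrincipalizationOfProp44
import Summits.ResolutionOfSingularities.ResolutionOfSingularities.Theorems.RadicialJungCleanModelsCleanLU3Defectless
import Summits.ResolutionOfSingularities.ResolutionOfSingularities.Theorems.RadicialJungCleanModelsCleanLU3Abhyankar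
import Summits.ResolutionOfSingularities.ResolutionOfSingularities.Theorems.RadicialJungCleanModelsCleanCharts3ZeroDim
import Summits.ResolutionOfSingularities.ResolutionOfSingularities.Theorems.RadicialJungCleanModelsStubCjs2020Cor15
import Summits.ResolutionOfSingularities.ResolutionOfSingularities.Theorems.RadicialJungCleanModelsCleanLU3ArcDiscrete
import Summits.ResolutionOfSingularities.ResolutionOfSingularities.Theorems.RadicialJungCleanModelsCleanLU3CompositeCdivCP
import Summits.ResolutionOfSingularities.ResolutionOfSingularities.Theorems.RadicialJungCleanModelsLens5PRankTwoPort5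
import Summits.ResolutionOfSingularities.ResolutionOfSingularities.Theorems.RadicialJungCleanModelsLens5TFramePDegreeC
import Summits.ResolutionOfSingularities.ResolutionOfSingularities.Theorems.RadicialJungCleanModelsLens5TFrameSepConst
import Summits.ResolutionOfSingularities.ResolutionOfSingularities.Theorems.RadicialJungCleanModelsLens5PTwoSlice
import Summits.ResolutionOfSingularities.ResolutionOfSingularities.Theorems.RadicialJungCleanModelsLens5KbarCossart
import Summits.ResolutionOfSingularities.ResolutionOfSingularities.Theorems.RadicialJungCleanModelsCcurveMainGen
import Literature.AlgebraicGeometry.Resolution.CossartFunctionNormalForm3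
import Literature.AlgebraicGeometry.Resolution.TranscendenceDefect
import Literature.AlgebraicGeometry.Resolution.EmbeddedResolutionCurvesInSurfaces
import Literature.AlgebraicGeometry.Resolution.LocalBlowup
import Literature.AlgebraicGeometry.Resolution.ExcellentRings
import Literature.AlgebraicGeometry.CossartPiltant200819.Thm15iBaseSidePhase2019
import HarnessLib

/-!
# `RadicialJung.CleanModels` from its registered inputs — the reduction of record, sorry-free and importable

Crux `stmt-ResolutionOfSingularities-15917` (`Summit.….Theses.RadicialJung.CleanModels`), line `via-clean-models`, skeleton
`Cruxes/CleanModels/Lines/Sketch.lean` rev 33 (crux 9dab1158a9a4, sha16 af8283babbf1ba12; line lead `res-B-lead-1` g0–g9).  The skeleton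
proves the crux BY NAME from seven `sorry`-stubs; this file is the SAME composition with the seven stubs turned into HYPOTHESES, so that the
reduction is a kernel-checked theorem with no `sorry`, importable by other routes and citable in the round verdict:

* `cleanLU3DefectNonDiscrete_of_inputs` — the rev-20/24 statement «clean LU at zero-dimensional, non-Abhyankar, immediate, non-discrete
  valuations» (odd `p`) from F-32 + F-02 + F-112 and the registered class-(B) research statement `hB` (= `stub_cleanLU3DefectNonDiscrete`
  rev 33, VERBATIM), through the landed slices (C-div) ✓ `cleanLU3Defect_of_divisorialCoarsening_cp`, T ✓
  `Lens5.PRankTwoAssembly.cleanLU3DefectPRankTwo_of_cossartPiltant2019`, T⁗‴ ✓ `Lens5TFrame.cleanLU3DefectPRankTwoPDeg_of_pMon`, T″/T‴ ✓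
  `Lens5TFrame.cleanLUConcl_of_sepConst`, `k = k̄` ✓ `Lens5.KbarCossart.cleanLU3DefectNonDiscrete_algClosed_of_cossart1987Thm`, composite ✓
  `Ccurve.cleanLU3Defect_of_properCoarsening`;
* `cleanLU3_of_inputs` — clean local uniformization at zero-dimensional valuation rings with a 3-dimensional regular centre, every `p`: at
  `p = 2` from the printed base-side phase of Cossart–Piltant 2019 Thm. 1.5 (i) ALONE (INPUTS wi-91399, the general-`p` typed fact
  `CossartPiltant2019_thm_1_5_i_baseSidePhase`, through ✓ `Lens5.PTwo.cleanLU3_of_eq_two`); at odd `p` by excluded middle on «best `p`-th-power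
  approximation» (✓ `cleanLU3_of_isMin_pthPowerApprox`), «Abhyankar» (✓ `cleanLU3_of_transcendenceDefect_eq_zero`, Kuhlmann), «discrete rank one»
  (✓ `cleanLU3DefectArc_of_discrete`, LEMMA D-abs + THEOREM P) and the previous theorem;
* `cleanModels_dimLEThree_of_inputs` — the crux RESTRICTED TO `dim W ≤ 3` from the four printed facts, `hB` and the registered research statement
  `h44c` (= `stub_cleanProp44`, X44c «clean CP 2008 Prop. 4.4 on clean stages», VERBATIM), through F-75c ✓ `stub_stacks0BICLocus` (dim ≤ 2) and the
  landed patching chain ✓ `stub_cleanCharts3` / ✓ `stub_cleanTwoModelPatching3` / ✓ `stub_cleanGlobalization3` / ✓ `stub_cleanPointBlowup` / ✓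
  `cleanPermissiblePrincipalization3_of_cleanProp44` / ✓ `stub_cleanPrincipalization3_of_cleanPermissiblePrincipalization` / ✓
  `cleanModelsDimThree_of_logCleanPrincipalizationDimThree`;
* `cleanModels_of_inputs` — the crux itself from the above and the frontier statement `hGE4` (= `stub_cleanModelsDimGEFour`, `dim W ≥ 4`, the
  rung-B PRICE, VERBATIM).

INPUT LEDGER of the dimension-3 slice, as kernel-checked here: PRINTED = F-32 `CossartJannsenSaito2020Embedded` (CJS 2020 Thm. 1.4, `B = ∅`) ·
F-02 `CossartPiltant2019` (CP 2019 Thm. 1.1) · F-112 `Cossart1987Thm` (Cossart 1987, `k = k̄`) · wi-91399 `CossartPiltant2019_thm_1_5_i_baseSidePhase`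
(used at `p = 2` only); RESEARCH (OURS, not in print as stated) = `hB` (class (B): `p` odd, zero-dimensional rank-one non-discrete
transcendence-defective `O`, the `K^p`-line of `g₀` immediate, Frobenius defect `d(K|K^p, v) ≥ p²` or infinite `p`-rank beyond separable
constants, `k ≠ k̄`) · `h44c` (X44c).  Nothing else.  The hypotheses are stated inline (no new definitions); every proof step is a landed
`Theorems/` declaration.

Honest framing: this is a CONDITIONAL packaging of the line's reduction; it proves nothing about resolution in characteristic `p`;
`CleanModels` in `dim ≥ 3` is unsettled (two research statements and the frontier are hypotheses here).
-/

noncomputable section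

set_option linter.dupNamespace false

open CategoryTheory AlgebraicGeometry
open Literature.AlgebraicGeometry.Resolution Literature.AlgebraicGeometry.Motives
open Literature.AlgebraicGeometry.CossartPiltant200819

namespace Summit.ResolutionOfSingularities.ResolutionOfSingularities.Theorems.RadicialJung.CleanModels.OfInputs

section Inputs

variable
  -- PRINTED F-32: Cossart–Jannsen–Saito 2020 Thm. 1.4 (`B = ∅`). [cite: CossartJannsenSaito2020, Thm. 1.4]
  (h32 : CossartJannsenSaito2020Embedded.{0})
  -- PRINTED F-02: Cossart–Piltant 2019 Thm. 1.1. [cite: CossartPiltant2019, Thm. 1.1]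
  (h02 : CossartPiltant2019.{0})
  -- PRINTED F-112: Cossart 1987 (`k = k̄`). [cite: Cossart1987, main theorem; Posva2024, App. A]
  (h112 : Cossart1987Thm)
  -- PRINTED wi-91399: Cossart–Piltant 2019 Thm. 1.5 (i), base-side `m = p` phase (every `p`; consumed at `p = 2`).
  (hBS : CossartPiltant2019_thm_1_5_i_baseSidePhase.{0})
  -- RESEARCH (OURS), class (B): `stub_cleanLU3DefectNonDiscrete` of Sketch rev 33, VERBATIM.
  (hB :
    ∀ (p : ℕ), p.Prime → p ≠ 2 →
    ∀ (k : Type) [Field k] [CharP k p] (K : Type) [Field K] [Algebra k K]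
    (O : ValuationSubring K) (A : Subalgebra k K), A.toSubring ≤ O.toSubring → A.FG → IsFractionRing A K →
    ringKrullDim A ≤ 3 → IsRegularLocalRing (locAtCentre A.toSubring O) →
    ringKrullDim (locAtCentre A.toSubring O) = 3 →
    (∀ (T : Subring K) (hT : T ≤ O.toSubring), A.toSubring ≤ T → (subringCentre T O hT).IsMaximal) →
    ∀ g₀ : K, (∀ c : K, c ^ p ≠ g₀) →
    (∀ f₀ : K, ∃ f₁ : K, O.valuation (g₀ - f₁ ^ p) < O.valuation (g₀ - f₀ ^ p)) →
    (∀ hk : ∀ c : k, algebraMap k K c ∈ O, transcendenceDefect k O hk ≠ 0) →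
    ¬ (∃ π : K, π ≠ 0 ∧ (∀ x : K, O.valuation x < 1 → O.valuation x ≤ O.valuation π) ∧
      (∀ x : K, x ≠ 0 → ∃ n : ℕ, O.valuation π ^ n ≤ O.valuation x)) →
    ¬ (∃ (O₁ : ValuationSubring K), O ≤ O₁ ∧ O₁ ≠ ⊤ ∧ ∃ y : Fin 2 → K, (∀ i, y i ∈ O) ∧
      ∀ P : MvPolynomial (Fin 2) k, P ≠ 0 → O₁.valuation (MvPolynomial.aeval y P) = 1) →
    ¬ (PerfectField k ∧ ∃ x y : K, x ≠ 0 ∧ y ≠ 0 ∧ ∀ a b : ℕ, a < p → b < p → (a ≠ 0 ∨ b ≠ 0) →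
      ∀ z : K, z ≠ 0 → O.valuation (x ^ a * y ^ b) ≠ O.valuation (z ^ p)) →
    ¬ ((∃ x y : K, x ≠ 0 ∧ y ≠ 0 ∧ ∀ a b : ℕ, a < p → b < p → (a ≠ 0 ∨ b ≠ 0) →
        ∀ z : K, z ≠ 0 → O.valuation (x ^ a * y ^ b) ≠ O.valuation (z ^ p)) ∧
      ∃ r : ℕ, Module.finrank (Subfield.closure (Set.range (fun x : k => x ^ p))) k = p ^ r ∧
        Module.finrank (Subfield.closure (Set.range (fun x : IsLocalRing.ResidueField O => x ^ p))) (IsLocalRing.ResidueField O) = p ^ r) →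
    ¬ ((∃ x y : K, x ≠ 0 ∧ y ≠ 0 ∧ ∀ a b : ℕ, a < p → b < p → (a ≠ 0 ∨ b ≠ 0) →
        ∀ z : K, z ≠ 0 → O.valuation (x ^ a * y ^ b) ≠ O.valuation (z ^ p)) ∧
      ∃ k' : IntermediateField k K, FiniteDimensional k k' ∧
        (∃ (n : ℕ) (s : Fin n → K), AlgebraicIndependent k' s ∧ Algebra.IsSeparable (IntermediateField.adjoin k' (Set.range s)) K) ∧
        ∃ _ : Algebra k' (IsLocalRing.ResidueField O),
          (∀ (c : k') (h : algebraMap k' K c ∈ O),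
            algebraMap k' (IsLocalRing.ResidueField O) c = IsLocalRing.residue O ⟨algebraMap k' K c, h⟩) ∧
          Algebra.IsSeparable k' (IsLocalRing.ResidueField O)) →
    ¬ IsAlgClosed k →
    ¬ (∃ O₁ : ValuationSubring K, O ≤ O₁ ∧ O₁ ≠ O ∧ O₁ ≠ ⊤) →
    ∃ (A' : Subalgebra k K), A'.toSubring ≤ O.toSubring ∧ A ≤ A' ∧ A'.FG ∧
    ∃ (_ : IsRegularLocalRing (locAtCentre A'.toSubring O)) (c : Fin p → K), (∃ j : Fin p, (j : ℕ) ≠ 0 ∧ c j ≠ 0) ∧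
    ((∃ (d m : ℕ) (hmd : m ≤ d) (t : Fin d → ↥(locAtCentre A'.toSubring O)) (a : Fin m → ℕ) (u : ↥(locAtCentre A'.toSubring O)), IsUnit u ∧
    Ideal.span (Set.range t) = IsLocalRing.maximalIdeal ↥(locAtCentre A'.toSubring O) ∧
    ringKrullDim ↥(locAtCentre A'.toSubring O) = (d : WithBot ℕ∞) ∧ 0 < m ∧ (∀ i, ¬ p ∣ a i) ∧
    (∑ j : Fin p, c j ^ p * g₀ ^ (j : ℕ)) = (u : K) * ∏ i : Fin m, ((t (Fin.castLE hmd i) : ↥(locAtCentre A'.toSubring O)) : K) ^ (a i)) ∨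
    (∃ u : ↥(locAtCentre A'.toSubring O), IsUnit u ∧ (∑ j : Fin p, c j ^ p * g₀ ^ (j : ℕ)) = (u : K) ∧
    ∀ c' : ↥(locAtCentre A'.toSubring O), u - c' ^ p ∉ IsLocalRing.maximalIdeal ↥(locAtCentre A'.toSubring O)) ∨
    (∃ s c' : ↥(locAtCentre A'.toSubring O), (∑ j : Fin p, c j ^ p * g₀ ^ (j : ℕ)) = (s : K) ∧
    s - c' ^ p ∈ IsLocalRing.maximalIdeal ↥(locAtCentre A'.toSubring O) ∧
    s - c' ^ p ∉ IsLocalRing.maximalIdeal ↥(locAtCentre A'.toSubring O) ^ 2)))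
  -- RESEARCH (OURS), X44c: `stub_cleanProp44` of Sketch rev 28–33, VERBATIM.
  (h44c :
    ∀ (p : ℕ), p.Prime → ∀ (S : Scheme.{0}) [IsIntegral S] [IsNoetherian S],
      CharP S.functionField p → Scheme.IsRegular S → Scheme.IsExcellent S → topologicalKrullDim S = 3 →
      ∀ G₀ : S.functionField, (∀ s : S, CleanRegAt p (algebraMap (S.presheaf.stalk s) S.functionField) G₀) →
      ∀ I : S.IdealSheafData, I ≠ ⊥ →
      ∀ (X : Scheme.{0}) (ρ : X ⟶ S) [IsIntegral X] [IsNoetherian X] [IsDominant ρ],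
        IsCleanRegularCentreBlowupSeq p ρ I G₀ →
        (∀ x : X, CleanRegAt p (algebraMap (X.presheaf.stalk x) X.functionField) (RatFn.functionFieldMap ρ G₀)) →
        ∀ (J : X.IdealSheafData) (μ : ℕ), 1 ≤ μ →
          (∀ x ∈ J.support, 1 < Order.coheight x) → (∀ x, idealOrder J x ≤ μ) → (∃ x, idealOrder J x = μ) →
          ∃ (X' : Scheme.{0}) (π : X' ⟶ X) (_ : IsIntegral X') (_ : IsDominant π) (J' : X'.IdealSheafData),
            IsCleanPermissibleSeq p π J μ J' (RatFn.functionFieldMap ρ G₀) ∧ ∀ x, idealOrder J' x < μ)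
  -- FRONTIER (rung-B PRICE): `stub_cleanModelsDimGEFour`, VERBATIM (`dim W ≥ 4`).
  (hGE4 :
      ∀ p : ℕ, p.Prime → ∀ (k : Type) [Field k] [CharP k p] (W : AlgebraicGeometry.Scheme.{0})
      [AlgebraicGeometry.IsIntegral W] (f : W ⟶ AlgebraicGeometry.Spec (.of k)) (L : Type) [Field L] [Algebra
      W.functionField L], AlgebraicGeometry.IsSeparated f → AlgebraicGeometry.LocallyOfFiniteType f →
      AlgebraicGeometry.QuasiCompact f → Literature.AlgebraicGeometry.Resolution.Scheme.IsRegular W →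
      IsPurelyInseparable W.functionField L → Module.finrank W.functionField L = p → ¬ topologicalKrullDim W ≤ 3 → ∃
      (V : AlgebraicGeometry.Scheme.{0}) (π : V ⟶ W) (_ : AlgebraicGeometry.IsIntegral V) (_ :
      AlgebraicGeometry.IsDominant π), AlgebraicGeometry.IsProper π ∧
      Literature.AlgebraicGeometry.Resolution.IsBirational π ∧
      Literature.AlgebraicGeometry.Resolution.Scheme.IsRegular V ∧ (∀ v : V, (∃ (y : L) (g : W.functionField), y ∉
      Set.range (algebraMap W.functionField L) ∧ algebraMap W.functionField L g = y ^ p ∧ ((∃ (d m : ℕ) (hmd : m ≤ d)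
      (t : Fin d → V.presheaf.stalk v) (a : Fin m → ℕ), Ideal.span (Set.range t) = IsLocalRing.maximalIdeal
      (V.presheaf.stalk v) ∧ ringKrullDim (V.presheaf.stalk v) = (d : WithBot ℕ∞) ∧ 0 < m ∧ (∀ i, ¬ p ∣ a i) ∧
      Literature.AlgebraicGeometry.Motives.RatFn.functionFieldMap π g = ∏ i : Fin m, (algebraMap (V.presheaf.stalk v)
      V.functionField (t (Fin.castLE hmd i))) ^ (a i)) ∨ (∃ u₀ : V.presheaf.stalk v, IsUnit u₀ ∧
      Literature.AlgebraicGeometry.Motives.RatFn.functionFieldMap π g = algebraMap (V.presheaf.stalk v)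
      V.functionField u₀ ∧ ((∀ c : V.presheaf.stalk v, u₀ - c ^ p ∉ IsLocalRing.maximalIdeal (V.presheaf.stalk v)) ∨
      (∃ c : V.presheaf.stalk v, u₀ - c ^ p ∈ IsLocalRing.maximalIdeal (V.presheaf.stalk v) ∧ u₀ - c ^ p ∉
      IsLocalRing.maximalIdeal (V.presheaf.stalk v) ^ 2)))))))

include h32 h02 h112 hB in
/-- The rev-20/24 node «clean LU at ZERO-DIMENSIONAL, NON-ABHYANKAR valuations where the line of `g₀` is IMMEDIATE and `O` is NOT discrete of
rank one», for ODD `p`, from the printed facts F-32/F-02/F-112 and the class-(B) research statement `hB`, by excluded middle on «divisorial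
coarsening» ((C-div) slice, F-32 + F-02), «`k` perfect and `[Γ:pΓ] = p²`» (THEOREM T, F-02 + F-32), «`[Γ:pΓ] = p²` and equal finite `p`-degrees»
(T⁗‴), «`[Γ:pΓ] = p²` and separable constants» (T″/T‴), «`k` algebraically closed» (F-112), «proper coarsening» (composite slice, F-02).
Composition identical to `cleanLU3DefectNonDiscrete_of_stubs` of Sketch rev 33. [folklore] -/
theorem cleanLU3DefectNonDiscrete_of_inputs :
    ∀ (p : ℕ), p.Prime → p ≠ 2 →
    ∀ (k : Type) [Field k] [CharP k p] (K : Type) [Field K] [Algebra k K]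
    (O : ValuationSubring K) (A : Subalgebra k K), A.toSubring ≤ O.toSubring → A.FG → IsFractionRing A K →
    ringKrullDim A ≤ 3 → IsRegularLocalRing (locAtCentre A.toSubring O) →
    ringKrullDim (locAtCentre A.toSubring O) = 3 →
    (∀ (T : Subring K) (hT : T ≤ O.toSubring), A.toSubring ≤ T → (subringCentre T O hT).IsMaximal) →
    ∀ g₀ : K, (∀ c : K, c ^ p ≠ g₀) →
    (∀ f₀ : K, ∃ f₁ : K, O.valuation (g₀ - f₁ ^ p) < O.valuation (g₀ - f₀ ^ p)) →
    (∀ hk : ∀ c : k, algebraMap k K c ∈ O, transcendenceDefect k O hk ≠ 0) →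
    ¬ (∃ π : K, π ≠ 0 ∧ (∀ x : K, O.valuation x < 1 → O.valuation x ≤ O.valuation π) ∧
      (∀ x : K, x ≠ 0 → ∃ n : ℕ, O.valuation π ^ n ≤ O.valuation x)) →
    ∃ (A' : Subalgebra k K), A'.toSubring ≤ O.toSubring ∧ A ≤ A' ∧ A'.FG ∧
    ∃ (_ : IsRegularLocalRing (locAtCentre A'.toSubring O)) (c : Fin p → K), (∃ j : Fin p, (j : ℕ) ≠ 0 ∧ c j ≠ 0) ∧
    ((∃ (d m : ℕ) (hmd : m ≤ d) (t : Fin d → ↥(locAtCentre A'.toSubring O)) (a : Fin m → ℕ) (u : ↥(locAtCentre A'.toSubring O)), IsUnit u ∧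
    Ideal.span (Set.range t) = IsLocalRing.maximalIdeal ↥(locAtCentre A'.toSubring O) ∧
    ringKrullDim ↥(locAtCentre A'.toSubring O) = (d : WithBot ℕ∞) ∧ 0 < m ∧ (∀ i, ¬ p ∣ a i) ∧
    (∑ j : Fin p, c j ^ p * g₀ ^ (j : ℕ)) = (u : K) * ∏ i : Fin m, ((t (Fin.castLE hmd i) : ↥(locAtCentre A'.toSubring O)) : K) ^ (a i)) ∨
    (∃ u : ↥(locAtCentre A'.toSubring O), IsUnit u ∧ (∑ j : Fin p, c j ^ p * g₀ ^ (j : ℕ)) = (u : K) ∧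
    ∀ c' : ↥(locAtCentre A'.toSubring O), u - c' ^ p ∉ IsLocalRing.maximalIdeal ↥(locAtCentre A'.toSubring O)) ∨
    (∃ s c' : ↥(locAtCentre A'.toSubring O), (∑ j : Fin p, c j ^ p * g₀ ^ (j : ℕ)) = (s : K) ∧
    s - c' ^ p ∈ IsLocalRing.maximalIdeal ↥(locAtCentre A'.toSubring O) ∧
    s - c' ^ p ∉ IsLocalRing.maximalIdeal ↥(locAtCentre A'.toSubring O) ^ 2)) := by
  intro p hp hp2 k _ _ K _ _ O A hAO hAfg hfrac hdimA hreg hdim3 hzd g₀ hg₀ hdefect htd hdisc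
  have hEmb := stub_cjs2020Cor15_of_embedded h32
  by_cases hdiv : ∃ (O₁ : ValuationSubring K), O ≤ O₁ ∧ O₁ ≠ ⊤ ∧ ∃ y : Fin 2 → K, (∀ i, y i ∈ O) ∧
      ∀ P : MvPolynomial (Fin 2) k, P ≠ 0 → O₁.valuation (MvPolynomial.aeval y P) = 1
  · obtain ⟨O₁, hOO₁, hO₁, y, hy, hind⟩ := hdiv
    exact cleanLU3Defect_of_divisorialCoarsening_cp hEmb h02 p hp k K O A hAO hAfg hfrac hdim3 hzd
      g₀ hg₀ hdefect O₁ hOO₁ hO₁ y hy hind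
  · by_cases hT : PerfectField k ∧ ∃ x y : K, x ≠ 0 ∧ y ≠ 0 ∧ ∀ a b : ℕ, a < p → b < p → (a ≠ 0 ∨ b ≠ 0) →
        ∀ z : K, z ≠ 0 → O.valuation (x ^ a * y ^ b) ≠ O.valuation (z ^ p)
    · obtain ⟨hperf, hP2⟩ := hT
      haveI := hperf
      haveI : Fact p.Prime := ⟨hp⟩
      exact Lens5.PRankTwoAssembly.cleanLU3DefectPRankTwo_of_cossartPiltant2019 p h02 hEmb
        k K O A hAO hAfg hfrac hdimA hreg hdim3 hzd g₀ hg₀ hdefect htd hdisc hP2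
    · by_cases hT4 : (∃ x y : K, x ≠ 0 ∧ y ≠ 0 ∧ ∀ a b : ℕ, a < p → b < p → (a ≠ 0 ∨ b ≠ 0) →
          ∀ z : K, z ≠ 0 → O.valuation (x ^ a * y ^ b) ≠ O.valuation (z ^ p)) ∧
        ∃ r : ℕ, Module.finrank (Subfield.closure (Set.range (fun x : k => x ^ p))) k = p ^ r ∧
          Module.finrank (Subfield.closure (Set.range (fun x : IsLocalRing.ResidueField O => x ^ p))) (IsLocalRing.ResidueField O) = p ^ r
      · obtain ⟨hP2, r, hk, hκ⟩ := hT4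
        haveI : Fact p.Prime := ⟨hp⟩
        exact Summit.ResolutionOfSingularities.ResolutionOfSingularities.Theorems.RadicialJungCleanModels.Lens5TFrame.cleanLU3DefectPRankTwoPDeg_of_pMon p
          (Summit.ResolutionOfSingularities.ResolutionOfSingularities.Theorems.RadicialJungCleanModels.Lens5TFrame.cleanLU3DefectPRankTwoPMon_of_cossartPiltant2019
            p h02 hEmb)
          k K O A hAO hAfg hfrac hdimA hreg hdim3 hzd g₀ hg₀ hdefect htd hdisc hP2 r hk hκ
      · by_cases hT6 : (∃ x y : K, x ≠ 0 ∧ y ≠ 0 ∧ ∀ a b : ℕ, a < p → b < p → (a ≠ 0 ∨ b ≠ 0) →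
            ∀ z : K, z ≠ 0 → O.valuation (x ^ a * y ^ b) ≠ O.valuation (z ^ p)) ∧
          ∃ k' : IntermediateField k K, FiniteDimensional k k' ∧
            (∃ (n : ℕ) (s : Fin n → K), AlgebraicIndependent k' s ∧ Algebra.IsSeparable (IntermediateField.adjoin k' (Set.range s)) K) ∧
            ∃ _ : Algebra k' (IsLocalRing.ResidueField O),
              (∀ (c : k') (h : algebraMap k' K c ∈ O),
                algebraMap k' (IsLocalRing.ResidueField O) c = IsLocalRing.residue O ⟨algebraMap k' K c, h⟩) ∧
              Algebra.IsSeparable k' (IsLocalRing.ResidueField O)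
        · haveI : Fact p.Prime := ⟨hp⟩
          exact Summit.ResolutionOfSingularities.ResolutionOfSingularities.Theorems.RadicialJungCleanModels.Lens5TFrame.cleanLUConcl_of_sepConst p
            (Summit.ResolutionOfSingularities.ResolutionOfSingularities.Theorems.RadicialJungCleanModels.Lens5TFrame.cleanLU3DefectPRankTwoSepConst_of_cossartPiltant2019 p h02
              (Summit.ResolutionOfSingularities.ResolutionOfSingularities.Theorems.RadicialJungCleanModels.Lens5TFrame.cleanLU3DefectPRankTwoSepRes_of_cossartPiltant2019 p h02
                hEmb))
            k K O A hAO hAfg hfrac hdimA hreg hdim3 hzd g₀ hg₀ hdefect htd hdisc hT6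
        · by_cases halg : IsAlgClosed k
          · exact Lens5.KbarCossart.cleanLU3DefectNonDiscrete_algClosed_of_cossart1987Thm p h112 hp k K O A hAO hAfg
              hfrac hdimA hreg hdim3 hzd g₀ hg₀ hdefect htd hdisc hdiv hT
          · by_cases hCc : ∃ O₁ : ValuationSubring K, O ≤ O₁ ∧ O₁ ≠ O ∧ O₁ ≠ ⊤
            · obtain ⟨O₁, hOO₁, hne, hO₁⟩ := hCc
              exact Ccurve.cleanLU3Defect_of_properCoarsening h02 p hp k K O A hAO hAfg hfrac hdimA hreg hdim3 hzd
                g₀ hg₀ hdiv O₁ hOO₁ hne hO₁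
            · exact hB p hp hp2 k K O A hAO hAfg hfrac hdimA hreg hdim3 hzd g₀ hg₀ hdefect htd hdisc hdiv hT hT4
                hT6 halg hCc

include h32 h02 h112 hBS hB in
/-- **Clean local uniformization at ZERO-DIMENSIONAL valuation rings with a 3-dimensional regular centre** (the hypothesis `hLU` of the landed
4a variant ✓ `cleanCharts3_of_cleanLU3ZeroDim`), every prime `p`, from the four printed facts and the class-(B) research statement `hB`:
`p = 2` from the printed base-side phase ALONE (✓ `Lens5.PTwo.cleanLU3_of_eq_two hBS`); for odd `p`, excluded middle on «best `p`-th-power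
approximation» (defectless half ✓ `cleanLU3_of_isMin_pthPowerApprox`, F-32), «transcendence defect `= 0`» (Abhyankar, Kuhlmann, ✓
`cleanLU3_of_transcendenceDefect_eq_zero`), «discrete rank one» (class (A), ✓ `cleanLU3DefectArc_of_discrete`), then the previous theorem.
Composition identical to `cleanLU3_of_stubs ∘ cleanLU3Defect_of_stubs` of Sketch rev 33. [folklore] -/
theorem cleanLU3_of_inputs :
    ∀ (p : ℕ), p.Prime →
    ∀ (k : Type) [Field k] [CharP k p] (K : Type) [Field K] [Algebra k K]
    (O : ValuationSubring K) (A : Subalgebra k K), A.toSubring ≤ O.toSubring → A.FG → IsFractionRing A K →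
    ringKrullDim A ≤ 3 → IsRegularLocalRing (locAtCentre A.toSubring O) →
    ringKrullDim (locAtCentre A.toSubring O) = 3 →
    (∀ (T : Subring K) (hT : T ≤ O.toSubring), A.toSubring ≤ T → (subringCentre T O hT).IsMaximal) →
    ∀ g₀ : K, (∀ c : K, c ^ p ≠ g₀) →
    ∃ (A' : Subalgebra k K), A'.toSubring ≤ O.toSubring ∧ A ≤ A' ∧ A'.FG ∧
    ∃ (_ : IsRegularLocalRing (locAtCentre A'.toSubring O)) (c : Fin p → K), (∃ j : Fin p, (j : ℕ) ≠ 0 ∧ c j ≠ 0) ∧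
    ((∃ (d m : ℕ) (hmd : m ≤ d) (t : Fin d → ↥(locAtCentre A'.toSubring O)) (a : Fin m → ℕ) (u : ↥(locAtCentre A'.toSubring O)), IsUnit u ∧
    Ideal.span (Set.range t) = IsLocalRing.maximalIdeal ↥(locAtCentre A'.toSubring O) ∧
    ringKrullDim ↥(locAtCentre A'.toSubring O) = (d : WithBot ℕ∞) ∧ 0 < m ∧ (∀ i, ¬ p ∣ a i) ∧
    (∑ j : Fin p, c j ^ p * g₀ ^ (j : ℕ)) = (u : K) * ∏ i : Fin m, ((t (Fin.castLE hmd i) : ↥(locAtCentre A'.toSubring O)) : K) ^ (a i)) ∨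
    (∃ u : ↥(locAtCentre A'.toSubring O), IsUnit u ∧ (∑ j : Fin p, c j ^ p * g₀ ^ (j : ℕ)) = (u : K) ∧
    ∀ c' : ↥(locAtCentre A'.toSubring O), u - c' ^ p ∉ IsLocalRing.maximalIdeal ↥(locAtCentre A'.toSubring O)) ∨
    (∃ s c' : ↥(locAtCentre A'.toSubring O), (∑ j : Fin p, c j ^ p * g₀ ^ (j : ℕ)) = (s : K) ∧
    s - c' ^ p ∈ IsLocalRing.maximalIdeal ↥(locAtCentre A'.toSubring O) ∧
    s - c' ^ p ∉ IsLocalRing.maximalIdeal ↥(locAtCentre A'.toSubring O) ^ 2)) := by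
  intro p hp k _ _ K _ _ O A hAO hAfg hfrac hdimA hreg hdim3 hzd g₀ hg₀
  by_cases hp2 : p = 2
  · exact Lens5.PTwo.cleanLU3_of_eq_two hBS p hp hp2 k K O A hAO hAfg hfrac hdimA hreg hdim3 hzd g₀ hg₀
  have hEmb := stub_cjs2020Cor15_of_embedded h32
  by_cases hbest : ∃ f₀ : K, ∀ f : K, O.valuation (g₀ - f₀ ^ p) ≤ O.valuation (g₀ - f ^ p)
  · obtain ⟨f₀, hf₀⟩ := hbest
    exact cleanLU3_of_isMin_pthPowerApprox hEmb p hp k K O A hAO hAfg hfrac hreg hdim3 g₀ hg₀ f₀ hf₀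
  · push Not at hbest
    have hk : ∀ c : k, algebraMap k K c ∈ O := fun c => hAO (A.algebraMap_mem c)
    by_cases htd : transcendenceDefect k O hk = 0
    · exact cleanLU3_of_transcendenceDefect_eq_zero hEmb p hp k K O A hAO hAfg hfrac hreg hdim3 g₀ hg₀ hk htd
    · have htd' : ∀ hk' : ∀ c : k, algebraMap k K c ∈ O, transcendenceDefect k O hk' ≠ 0 :=
        fun hk' => (by exact htd : transcendenceDefect k O hk ≠ 0)
      by_cases hdisc : (∃ π : K, π ≠ 0 ∧ (∀ x : K, O.valuation x < 1 → O.valuation x ≤ O.valuation π) ∧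
          (∀ x : K, x ≠ 0 → ∃ n : ℕ, O.valuation π ^ n ≤ O.valuation x))
      · exact cleanLU3DefectArc_of_discrete p hp k K O A hAO hAfg hfrac hdimA hreg hdim3 hzd g₀ hg₀ hbest htd' hdisc
      · exact cleanLU3DefectNonDiscrete_of_inputs h32 h02 h112 hB p hp hp2 k K O A hAO hAfg hfrac hdimA hreg hdim3 hzd g₀
          hg₀ hbest htd' hdisc

include h32 h02 h112 hBS hB h44c in
/-- **The crux `RadicialJung.CleanModels` RESTRICTED TO `dim W ≤ 3`** from the four printed facts F-32/F-02/F-112/wi-91399 and the two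
research statements `hB` (class (B)) and `h44c` (X44c): `dim W ≤ 2` by F-75c (✓ `stub_stacks0BICLocus`, ✓ `cleanModels_dimLETwo_of_f75c`);
`dim W = 3` by the landed patching chain for clean pairs — ✓ `stub_cleanGlobalization3` over ✓ `cleanCharts3_of_cleanLU3ZeroDim
(cleanLU3_of_inputs …)` and ✓ `stub_cleanTwoModelPatching3` over the principalization node ✓
`stub_cleanPrincipalization3_of_cleanPermissiblePrincipalization (cleanPermissiblePrincipalization3_of_cleanProp44 h44c) stub_cleanPointBlowup` —
fed to the landed pointwise reduction ✓ `cleanModelsDimThree_of_logCleanPrincipalizationDimThree`.  Composition identical to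
`cleanModelsDimThree_of_stubs ∘ cleanPatching3_of_stubs` of Sketch rev 33 plus the `dim ≤ 2` branch of `CleanModels_of`. [folklore] -/
theorem cleanModels_dimLEThree_of_inputs :
    ∀ p : ℕ, p.Prime → ∀ (k : Type) [Field k] [CharP k p] (W : AlgebraicGeometry.Scheme.{0}) [AlgebraicGeometry.IsIntegral W]
      (f : W ⟶ AlgebraicGeometry.Spec (.of k)) (L : Type) [Field L] [Algebra W.functionField L],
      AlgebraicGeometry.IsSeparated f → AlgebraicGeometry.LocallyOfFiniteType f → AlgebraicGeometry.QuasiCompact f →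
      Literature.AlgebraicGeometry.Resolution.Scheme.IsRegular W → IsPurelyInseparable W.functionField L →
      Module.finrank W.functionField L = p → topologicalKrullDim W ≤ 3 →
      ∃ (V : AlgebraicGeometry.Scheme.{0}) (π : V ⟶ W) (_ : AlgebraicGeometry.IsIntegral V) (_ : AlgebraicGeometry.IsDominant π),
        AlgebraicGeometry.IsProper π ∧ Literature.AlgebraicGeometry.Resolution.IsBirational π ∧
        Literature.AlgebraicGeometry.Resolution.Scheme.IsRegular V ∧ (∀ v : V, (∃ (y : L) (g : W.functionField),
          y ∉ Set.range (algebraMap W.functionField L) ∧ algebraMap W.functionField L g = y ^ p ∧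
          ((∃ (d m : ℕ) (hmd : m ≤ d) (t : Fin d → V.presheaf.stalk v) (a : Fin m → ℕ),
              Ideal.span (Set.range t) = IsLocalRing.maximalIdeal (V.presheaf.stalk v) ∧
              ringKrullDim (V.presheaf.stalk v) = (d : WithBot ℕ∞) ∧ 0 < m ∧ (∀ i, ¬ p ∣ a i) ∧
              Literature.AlgebraicGeometry.Motives.RatFn.functionFieldMap π g =
                ∏ i : Fin m, (algebraMap (V.presheaf.stalk v) V.functionField (t (Fin.castLE hmd i))) ^ (a i)) ∨
            (∃ u₀ : V.presheaf.stalk v, IsUnit u₀ ∧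
              Literature.AlgebraicGeometry.Motives.RatFn.functionFieldMap π g = algebraMap (V.presheaf.stalk v) V.functionField u₀ ∧
              ((∀ c : V.presheaf.stalk v, u₀ - c ^ p ∉ IsLocalRing.maximalIdeal (V.presheaf.stalk v)) ∨
                (∃ c : V.presheaf.stalk v, u₀ - c ^ p ∈ IsLocalRing.maximalIdeal (V.presheaf.stalk v) ∧
                  u₀ - c ^ p ∉ IsLocalRing.maximalIdeal (V.presheaf.stalk v) ^ 2)))))) := by
  intro p hp k _ _ W _ f L _ _ hs hl hq hr hpi hd h3
  by_cases h2 : topologicalKrullDim W ≤ 2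
  · haveI := hs; haveI := hl; haveI := hq; haveI := hpi
    exact cleanModels_dimLETwo_of_f75c stub_stacks0BICLocus p hp k W f hr L hd h2
  · exact cleanModelsDimThree_of_logCleanPrincipalizationDimThree
      (stub_cleanGlobalization3 (cleanCharts3_of_cleanLU3ZeroDim (cleanLU3_of_inputs h32 h02 h112 hBS hB))
        (stub_cleanTwoModelPatching3
          (stub_cleanPrincipalization3_of_cleanPermissiblePrincipalization
            (cleanPermissiblePrincipalization3_of_cleanProp44 h44c) stub_cleanPointBlowup)))
      p hp k W f L hs hl hq hr hpi hd h2 h3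

include h32 h02 h112 hBS hB h44c hGE4 in
/-- **The crux `Theses.RadicialJung.CleanModels` BY NAME from its seven registered inputs** (Sketch rev 33): four PRINTED facts
(F-32 `CossartJannsenSaito2020Embedded`, F-02 `CossartPiltant2019`, F-112 `Cossart1987Thm`, wi-91399 `CossartPiltant2019_thm_1_5_i_baseSidePhase`),
two RESEARCH statements (`hB` class (B), `h44c` X44c) and the FRONTIER statement `hGE4` (`dim W ≥ 4`, the rung-B PRICE) — cases on
`topologicalKrullDim W ≤ 3`.  A CONDITIONAL packaging of the line's reduction, not a proof of the crux. [folklore] -/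
theorem cleanModels_of_inputs :
    Summit.ResolutionOfSingularities.ResolutionOfSingularities.Theses.RadicialJung.CleanModels := by
  intro p hp k _ _ W _ f L _ _ hs hl hq hr hpi hd
  by_cases h3 : topologicalKrullDim W ≤ 3
  · exact cleanModels_dimLEThree_of_inputs h32 h02 h112 hBS hB h44c p hp k W f L hs hl hq hr hpi hd h3
  · exact hGE4 p hp k W f L hs hl hq hr hpi hd h3

end Inputs

end Summit.ResolutionOfSingularities.ResolutionOfSingularities.Theorems.RadicialJung.CleanModels.OfInputs

end
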